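import Summits.MatrixMultiplication.MatrixMultiplication.Theses.OctonionicLaser
import Literature.Computability.AlgebraicComplexity.FlatteningRank
import Literature.Barriers.MatrixMultiplication.UniversalMethodBarrierAsymptoticRank

/-!
# MatrixMultiplication / OctonionicLaser — `OctLowerFrame`: `8 ≤ R̃(t₈)`

Route `route-MatrixMultiplication-OctonionicLaser`, support item `stmt-MatrixMultiplication-7936`
(`OctLowerFrame`): the asymptotic rank of the (inlined) structure tensor `t₈` of the complex
octonions — the Cayley–Dickson double of `M₂(ℂ)` with the adjugate as involution, index type
`Fin 2 × Fin 2 × Fin 2` = (grading bit, matrix unit), first slot = output — is at least `8`.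

Proof: the first flattening (output slices) of `t₈` has rank `8`, because the algebra is unital:
for every output coordinate `o` there is a pair of input coordinates `(P o, Q o)` with
`t₈ o' (P o) (Q o) = [o' = o]` (for `o = (0,(i,l))` take `E_{i0} · E_{0l} = E_{il}` in the
`(0;0,0)` block, for `o = (1,(i,l))` take `d = E_{i0}`, `a = E_{0l}` in the `(1;0,1)` block
`da`), so the eight output slices are linearly independent (`card_le_asymptoticRank_of_dualPairs`),
and the flattening rank is a lower bound for the asymptotic rank
(`Literature.Barriers.MatrixMultiplication.flatteningRank_le_asymptoticRank`, i.e. gauge points are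
spectral points `≤ R̃`; Christandl–Vrana–Zuiddam 2023, Example 1.4; Bläser 2013, Lemma 7.1 (2)).
-/

-- Summit-side namespace `Summit.<Summit>.<Sub>.Theorems`; for this single-conjunct summit the two
-- coincide (`MatrixMultiplication.MatrixMultiplication`), so the file silences `dupNamespace`.
set_option linter.dupNamespace false

namespace Summit.MatrixMultiplication.MatrixMultiplication.Theorems

open Literature.Computability.AlgebraicComplexity

/-- **Dual pairs give a flattening lower bound for `R̃`.** If for every first-slot coordinate `o`
there are coordinates `P o`, `Q o` of the other two slots with `t o' (P o) (Q o) = [o' = o]`, then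
the `x`-slices of `t` are linearly independent, so `|ι| = ζ⁽¹⁾(t) ≤ R̃(t)`
(Bläser 2013, proof of Lemma 7.1 (2); CVZ 2023, Example 1.4). [cite: Blaser2013, Lemma 7.1 (2) (proof)] -/
theorem card_le_asymptoticRank_of_dualPairs {ι κ μ : Type} [Fintype ι] [Fintype κ] [Fintype μ]
    [DecidableEq ι] (t : ι → κ → μ → ℂ) (P : ι → κ) (Q : ι → μ)
    (h : ∀ o o', t o' (P o) (Q o) = if o' = o then 1 else 0) :
    (Fintype.card ι : ℝ) ≤ asymptoticRank t := by
  have hli : LinearIndependent ℂ (xSlices t) := by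
    rw [Fintype.linearIndependent_iff]
    intro g hg o
    have key := congrFun hg (P o, Q o)
    rw [Finset.sum_apply, Pi.zero_apply] at key
    simp only [Pi.smul_apply, xSlices_apply, smul_eq_mul, h] at key
    simpa using key
  have hfr : flatteningRank t = Fintype.card ι := by
    unfold flatteningRank
    exact finrank_span_eq_card hli
  have hle := Literature.Barriers.MatrixMultiplication.flatteningRank_le_asymptoticRank t
  rw [hfr] at hle
  exact hle

/-- **`OctLowerFrame`** (item `stmt-MatrixMultiplication-7936`): `8 ≤ R̃(t₈)` for the inlined
octonion tensor `t₈` — its eight output slices are linearly independent (unital algebra: dual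
pairs `E_{i0}E_{0l} = E_{il}` in the blocks `(0;0,0)` and `(1;0,1)`), and `ζ⁽¹⁾ ≤ R̃`.
[cite: ChristandlVranaZuiddam2023, Example 1.4] -/
theorem OctLowerFrame_proof :
    Summit.MatrixMultiplication.MatrixMultiplication.Theses.OctonionicLaser.OctLowerFrame := by
  unfold Summit.MatrixMultiplication.MatrixMultiplication.Theses.OctonionicLaser.OctLowerFrame
  have h8 : (8 : ℝ) = (Fintype.card (Fin 2 × Fin 2 × Fin 2) : ℝ) := by norm_num
  rw [h8]
  refine card_le_asymptoticRank_of_dualPairs _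
    (fun o => ((0 : Fin 2), (if o.1 = 0 then (o.2.1, (0 : Fin 2)) else ((0 : Fin 2), o.2.2))))
    (fun o => (if o.1 = 0 then ((0 : Fin 2), ((0 : Fin 2), o.2.2))
      else ((1 : Fin 2), (o.2.1, (0 : Fin 2)))))
    ?_
  rintro ⟨b, i, l⟩ ⟨b', i', l'⟩
  fin_cases b <;> fin_cases b' <;>
    simp [Matrix.single_apply, Prod.ext_iff] <;> split_ifs <;> simp_all

end Summit.MatrixMultiplication.MatrixMultiplication.Theorems
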